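import Summits.BirchSwinnertonDyer.BirchSwinnertonDyer.Theorems.GenusKolyvaginAtTwoVisiblePairAtTwoDeepening
import Summits.BirchSwinnertonDyer.Rank1Residual.X11b.TorsionLevelCohomology
import Literature.NumberTheory.EllipticCurves.TwoAdicImageQuadraticTwistProofs
import Literature.NumberTheory.EllipticCurves.TwoAdicImageSurjectivityModTwoProofs
import HarnessLib

/-!
# Route `GenusKolyvaginAtTwo`, LINE 6, KEY crux Q3 (inner statement of stmt-BirchSwinnertonDyer-22137):
# the change of level `ι : H¹(ℚ, ·[2]) → H¹(ℚ, ·[2^M])` is INJECTIVE on the habitat — the non-vanishing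
# inputs and the Lemma 4.6 link of the deepening step discharged (helper, PROVED; seat `bsd-line-gk2-p2` g11)

`…VisiblePairAtTwoDeepening` (this seat) leaves displayed, besides the printed inputs, the non-vanishing of
the embedded classes `ι u`, `ι y₀` at level `2^M` and the link `c_1(ℓ)_{λ₀} ≠ 0 ⟹ 2^{M−1} c₂(ℓ) ≠ 0`. All
three reduce to the INJECTIVITY of `ι = torsionH1OfDvd` (`E[p^a] ↪ E[p^j]` on `H¹`), which holds as soon as
`E(F)[p] = 0` (kernel = connecting classes of `E[p^j]^{Γ_F} = 0`; Greenberg LNM 1716 §2): the tree's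
`ShimuraKolyvaginFixedOfTorsion.torsionH1OfDvd_pow_injective_of_torsionBy_eq_bot` (for `E_K`, `K` a number
field) re-run for a curve over the base field itself, and on the habitat `E(ℚ)[2] = 0 = E^{(d_K)}(ℚ)[2]`
(`ρ̄_{E,2}` onto; Dokchitser–Dokchitser, twist-invariant).

* `geomTorsion_pow_eq_zero_of_fixed`, `torsionH1OfDvd_pow_injective` — any number field `F`, any `E/F` with
  `E(F)[p] = 0`, levels `p^a ∣ p^j`;
* `torsionH1OfDvd_lvl_injective`, `torsionH1OfDvd_lvl_twin_injective` — the instance (`ρ̄_{E,2}` onto);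
* `exists_kolPrime_pow_zsmul_ne_zero_of_ne_zero` — the deep certificate from `u ≠ 0`, `y₀ ≠ 0` at level `2`
  and the Lemma 4.6 IDENTITY `ι c_1(ℓ) = 2^{M−1} c₂(ℓ)` (displayed, like the descent identities of `Input`).

Helper (`--supports` 22137), closes nothing; THEOREMS ONLY, 0 sorry, standard axioms. BSD is not proved by this.

References: [GreenbergLNM1716] §2 p. 63; [GrossLMS1991] §4 Lemma 4.3; [McCallumLMS1991] §4 (5), Lemma 4.6,
§5 Prop. 5.2; [DokchitserDokchitserMathZ2012] Theorem (1).
-/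

set_option autoImplicit false
set_option linter.dupNamespace false -- tree convention: `Summit.BirchSwinnertonDyer.BirchSwinnertonDyer.Theorems` (summit = sub-problem)

noncomputable section

open scoped Classical

universe u

namespace Summit.BirchSwinnertonDyer.BirchSwinnertonDyer.Theorems.GenusExact.VisiblePairAtTwo

open WeierstrassCurve NumberField IsDedekindDomain Field Finset Rat.HeightOneSpectrum
open Literature.NumberTheory.EllipticCurves Literature.NumberTheory.GaloisRepresentations
open Literature.NumberTheory.EllipticCurves.KolyvaginDescent
open Summit.BirchSwinnertonDyer.Rank1Residual

/-! ## §1 `E(F)[p] = 0 ⟹ E[p^j]^{Γ_F} = 0 ⟹ ι : H¹(F, E[p^a]) → H¹(F, E[p^j])` injective -/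

section General

variable {F : Type u} [Field F] [NumberField F] (W : WeierstrassCurve F)

/-- **No non-zero `Γ_F`-fixed point in `E(F̄)[p^j]` when `E(F)[p] = 0`** (any number field `F`): a fixed point
is `F`-rational (`exists_toGeomPoints_eq_of_forall_smul_eq`) and `p`-power torsion, hence `0`. (The tree's
`ShimuraKolyvaginFixedOfTorsion.geomTorsion_pow_eq_zero_of_fixed_of_torsionBy_eq_bot`, for a curve over the
base field itself.) [cite: GrossLMS1991, §4 Lemma 4.3] -/
theorem geomTorsion_pow_eq_zero_of_fixed {p : ℕ}
    (hbot : AddSubgroup.torsionBy W.toAffine.Point (p : ℤ) = ⊥) (j : ℕ)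
    (P : geomTorsion W ((p ^ j : ℕ) : ℤ)) (hP : ∀ σ : absoluteGaloisGroup F, σ • P = P) : P = 0 := by
  haveI : PerfectField F := PerfectField.ofCharZero
  have hA : ∀ a : W.toAffine.Point, p • a = 0 → a = 0 := fun a ha ↦ by
    have : a ∈ AddSubgroup.torsionBy W.toAffine.Point (p : ℤ) := by
      rw [mem_torsionBy_iff, natCast_zsmul]; exact ha
    rw [hbot] at this
    exact this
  have hpow : ∀ (j : ℕ) (R : W.toAffine.Point), p ^ j • R = 0 → R = 0 := by
    intro j
    induction j with
    | zero => intro R h; simpa using h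
    | succ j ih =>
      intro R h
      exact ih R (hA _ (by rw [← mul_nsmul, ← pow_succ]; exact h))
  have hfix : ∀ σ : absoluteGaloisGroup F, σ • (P : geomPoints W) = P :=
    fun σ ↦ congrArg Subtype.val (hP σ)
  obtain ⟨R, hR⟩ := exists_toGeomPoints_eq_of_forall_smul_eq W hfix
  have hRj : p ^ j • R = 0 := by
    apply toGeomPoints_injective W
    rw [map_nsmul, hR, map_zero, ← natCast_zsmul]
    push_cast
    exact (mem_geomTorsion_iff _ _ _).mp P.2
  apply Subtype.ext
  rw [ZeroMemClass.coe_zero, ← hR, hpow j R hRj, map_zero]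

/-- **`ι : H¹(F, E[p^a]) → H¹(F, E[p^j])` is injective when `E(F)[p] = 0`** (`p^a ∣ p^j`, any number field
`F`): the kernel consists of connecting classes of `E[p^j]^{Γ_F} = 0` (`X11b.Levels.map_one_injective_of_forall_fixed_eq_zero`
through `map_torsionInclusion_one_apply`). McCallum's (5). [cite: GreenbergLNM1716, §2 p. 63]
[cite: McCallumLMS1991, §4 (5)] -/
theorem torsionH1OfDvd_pow_injective [W.IsElliptic] {p : ℕ}
    (hbot : AddSubgroup.torsionBy W.toAffine.Point (p : ℤ) = ⊥) {a j : ℕ}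
    (h : ((p ^ a : ℕ) : ℤ) ∣ ((p ^ j : ℕ) : ℤ)) : Function.Injective (torsionH1OfDvd W h) := by
  have key : Function.Injective (galoisCohomology.map (W.torsionInclusion h) 1) := by
    refine X11b.Levels.map_one_injective_of_forall_fixed_eq_zero (n := p ^ a) ?_ ?_ ?_ ?_
    · intro b hb
      have hb' : ((p ^ a : ℕ) : ℤ) • (b : geomPoints W) = 0 := by
        rw [natCast_zsmul, ← AddSubmonoidClass.coe_nsmul, hb, ZeroMemClass.coe_zero]
      exact ⟨⟨(b : geomPoints W), (mem_geomTorsion_iff _ _ _).2 hb'⟩, Subtype.ext rfl⟩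
    · intro x x' hxx
      exact Subtype.ext (congrArg (fun P : geomTorsion W ((p ^ j : ℕ) : ℤ) ↦ (P : geomPoints W)) hxx)
    · intro x
      apply Subtype.ext
      rw [AddSubmonoidClass.coe_nsmul, ZeroMemClass.coe_zero, ← natCast_zsmul]
      exact (mem_geomTorsion_iff _ _ _).1 x.2
    · intro b hb
      exact geomTorsion_pow_eq_zero_of_fixed W hbot j b fun σ ↦ by
        have h := hb σ
        rwa [torsionGaloisModule_apply_apply] at h
  intro x y hxy
  apply key
  rw [map_torsionInclusion_one_apply, map_torsionInclusion_one_apply]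
  exact hxy

end General

/-! ## §2 The instance: `ρ̄_{E,2}` onto ⟹ `ι` injective for `E` and for the twin -/

section Instance

variable (W : WeierstrassCurve ℚ) [W.IsElliptic] [W.IsGloballyMinimal] (K : Type) [Field K] [NumberField K]

omit [W.IsGloballyMinimal] in
/-- `ρ̄_{E,2}` onto ⟹ `E(ℚ)[2] = 0` (Dokchitser–Dokchitser (1)); stated for ANY decidability instance on `ℚ`
(the group law on `W.toAffine.Point` is built on one; the general-field lemmas use the classical one).
[cite: DokchitserDokchitserMathZ2012, Theorem (1)] -/
theorem torsionBy_two_eq_bot_of_surj {dec : DecidableEq ℚ} (hρ2 : W.HasSurjectiveModNGaloisRep 2) :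
    AddSubgroup.torsionBy W.toAffine.Point ((2 : ℕ) : ℤ) = ⊥ := by
  rw [eq_bot_iff]
  intro P hP
  rw [AddSubgroup.mem_bot]
  rw [mem_torsionBy_iff, natCast_zsmul] at hP
  refine DokchitserDokchitser2012.forall_two_nsmul_of_hasSurjectiveModNGaloisRep_two W two_ne_zero hρ2 P ?_
  convert hP

omit [W.IsGloballyMinimal] in
/-- **`ι : H¹(ℚ, E[2]) → H¹(ℚ, E[2^M])` is injective** when `ρ̄_{E,2}` is onto. [cite: McCallumLMS1991, §4 (5)] -/
theorem torsionH1OfDvd_lvl_injective (hρ2 : W.HasSurjectiveModNGaloisRep 2) {M : ℕ} (hM : 1 ≤ M) :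
    Function.Injective (torsionH1OfDvd W (lvl_one_dvd_lvl hM)) :=
  torsionH1OfDvd_pow_injective W (p := 2) (a := 1) (j := M) (torsionBy_two_eq_bot_of_surj W hρ2)
    (lvl_one_dvd_lvl hM)

omit [W.IsGloballyMinimal] in
/-- **`ι : H¹(ℚ, E^{(d_K)}[2]) → H¹(ℚ, E^{(d_K)}[2^M])` is injective** when `ρ̄_{E,2}` is onto (`ρ̄_{E^{(d)},2}`
onto ⟺ `ρ̄_{E,2}` onto, `hasSurjectiveModNGaloisRep_two_quadraticTwist_iff`). [cite: McCallumLMS1991, §4 (5)]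
[cite: DokchitserDokchitserMathZ2012, Theorem (1)] -/
theorem torsionH1OfDvd_lvl_twin_injective [(twin W K).IsElliptic] (hρ2 : W.HasSurjectiveModNGaloisRep 2)
    {M : ℕ} (hM : 1 ≤ M) : Function.Injective (torsionH1OfDvd (twin W K) (lvl_one_dvd_lvl hM)) := by
  have hd : ((NumberField.discr K : ℤ) : ℚ) ≠ 0 := by exact_mod_cast NumberField.discr_ne_zero K
  have hρ2' : (twin W K).HasSurjectiveModNGaloisRep 2 :=
    (hasSurjectiveModNGaloisRep_two_quadraticTwist_iff W hd).mpr hρ2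
  exact torsionH1OfDvd_pow_injective (twin W K) (p := 2) (a := 1) (j := M)
    (torsionBy_two_eq_bot_of_surj (twin W K) hρ2') (lvl_one_dvd_lvl hM)

/-! ## §3 The deep certificate from level-`2` non-vanishing and the Lemma 4.6 identity -/

variable (M : ℕ) {θ : K} (hθ : θ ∉ Set.range (algebraMap ℚ K))
  (hθsq : θ ^ 2 = algebraMap ℚ K ((NumberField.discr K : ℤ) : ℚ))

/-- **The deep certificate of the ℚ-pair instance**, non-vanishing read at level `2` and the link as
McCallum's Lemma 4.6 IDENTITY `ι c_1(ℓ) = 2^{M−1} c₂(ℓ)` (`hι`): on the LINE-6 habitat, from a shallow prime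
`ℓ₀`, `y₀ = c_1(ℓ₀) ≠ 0`, an auxiliary `u ≠ 0` Selmer off `ℓ₀`, the level-`2` classes with Lemma 4.3 /
Prop. 4.4 and the visibility of `{ι u, ι y₀}`: **a Kolyvagin prime `ℓ` of the instance with
`2^{M−1}·c₂ ℓ ≠ 0`** — the certificate of `VisiblePairHypothesesM.sel₁_eq_and_card_sel₂_eq_of_primitive`.
[cite: McCallumLMS1991, §5 Prop. 5.2, §4 Lemma 4.6 and (5)] -/
theorem exists_kolPrime_pow_zsmul_ne_zero_of_ne_zero (hcm : ¬ W.HasCM) (hΔ : W.Δ < 0)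
    (hK : IsImaginaryQuadratic K) (hodd : Odd (NumberField.discr K))
    (hns : ¬ IsSquare ((NumberField.discr K : ℚ) * -|W.Δ|))
    (hρ : ∀ n : ℕ, W.HasSurjectiveModNGaloisRep (2 ^ n : ℕ)) [(twin W K).IsElliptic] (hM : 1 ≤ M)
    {ℓ₀ : ℕ} (hℓ₀ : ℓ₀.Prime) (y₀ : galH1Torsion (twin W K) (lvl 1)) (hy0 : y₀ ≠ 0)
    (u : galH1Torsion W (lvl 1)) (hu0 : u ≠ 0) (hu : ∀ v, v ≠ pl ℓ₀ → u ∈ loc₁ W 1 v)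
    (uu : ℕ → galH1Torsion W (lvl 1)) (w : ℕ → galH1Torsion (twin W K) (lvl 1))
    (h43 : ∀ ℓ, kolPrime W K M ℓ → ℓ ≠ ℓ₀ → ∀ v, v ≠ pl ℓ₀ → v ≠ pl ℓ → uu ℓ ∈ loc₁ W 1 v)
    (h44sel : ∀ ℓ, kolPrime W K M ℓ → ℓ ≠ ℓ₀ → (uu ℓ ∈ loc₁ W 1 (pl ℓ) ↔ y₀ ∈ a₂ W K 1 ℓ))
    (h44ord : ∀ ℓ, kolPrime W K M ℓ → ℓ ≠ ℓ₀ → (uu ℓ ∈ a₁ W 1 ℓ₀ ↔ w ℓ ∈ a₂ W K 1 ℓ₀))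
    (hvis : ∀ a₁' a₂' : ℤ, rK₁ W K M (a₁' • torsionH1OfDvd W (lvl_one_dvd_lvl hM) u) +
      rK₂ W M hθ hθsq (a₂' • torsionH1OfDvd (twin W K) (lvl_one_dvd_lvl hM) y₀) = 0 →
      a₁' • torsionH1OfDvd W (lvl_one_dvd_lvl hM) u = 0 ∧
        a₂' • torsionH1OfDvd (twin W K) (lvl_one_dvd_lvl hM) y₀ = 0)
    (c₂ : ℕ → galH1Torsion (twin W K) (lvl M))
    (hι : ∀ ℓ, kolPrime W K M ℓ →
      torsionH1OfDvd (twin W K) (lvl_one_dvd_lvl hM) (w ℓ) = ((2 : ℤ) ^ (M - 1)) • c₂ ℓ) :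
    ∃ ℓ, kolPrime W K M ℓ ∧ ((2 : ℤ) ^ (M - 1)) • c₂ ℓ ≠ 0 := by
  have hρ2 : W.HasSurjectiveModNGaloisRep 2 := by simpa using hρ 1
  have hinj := torsionH1OfDvd_lvl_injective W hρ2 hM
  have hinj' := torsionH1OfDvd_lvl_twin_injective W K hρ2 hM
  have hu0' : torsionH1OfDvd W (lvl_one_dvd_lvl hM) u ≠ 0 := fun h ↦
    hu0 (hinj (by rw [h, map_zero]))
  have hy0' : torsionH1OfDvd (twin W K) (lvl_one_dvd_lvl hM) y₀ ≠ 0 := fun h ↦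
    hy0 (hinj' (by rw [h, map_zero]))
  refine exists_kolPrime_pow_zsmul_ne_zero W K M hθ hθsq hcm hΔ hK hodd hns hρ hM hℓ₀ y₀ u hu uu w h43
    h44sel h44ord hu0' hy0' hvis c₂ fun ℓ hkol _ hw ↦ ?_
  -- `c_1(ℓ) ∉ a₂ W K 1 ℓ₀ ⟹ c_1(ℓ) ≠ 0 ⟹ ι c_1(ℓ) ≠ 0 ⟹ 2^{M-1} c₂(ℓ) ≠ 0`
  rw [← hι ℓ hkol]
  intro h0
  apply hw
  have hw0 : w ℓ = 0 := hinj' (by rw [h0, map_zero])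
  rw [hw0]
  exact AddSubgroup.zero_mem _

end Instance

end Summit.BirchSwinnertonDyer.BirchSwinnertonDyer.Theorems.GenusExact.VisiblePairAtTwo

end
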